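import Summits.CriticalPhenomena.PercolationContinuityZ3.Theorems.PercNearOneGluingNoHeavyLowerTailEventGluingSharp
import HarnessLib

/-!
# Kozma–Nitzan: (GENmin) for every monotone cluster functional (the sign hypothesis of (GEN) dropped)

Support file (`--supports stmt-CriticalPhenomena-4575`), cell perc-kn (req609-KN), file F1, lead `perc-kn-lead` (g0).  No definitions,
no named facts, no sorries; standard axioms.  Statement of record: `Cruxes/NoHeavyLowerTail/Lines/kn_genmin.lean`.

`EventGluingSharp.gen_holds` is (GEN) — `Σ_{a∈A} μ(P^o_a)·E F(C_a) ≤ E[F(C_o); o ↔ A]`, first-in-rank patterns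
`P^o_a = {o ↔ a} ∩ ⋂_{a'∈A, r a' < r a} {o ↮ a'}` — for monotone NONNEGATIVE `F`.  Here the hypothesis `0 ≤ F` is removed (apply (GEN) to
`F − F(∅) ≥ 0` and use that the patterns partition `{o ↔ A}`, `AGloc.sum_measureReal_firstRank`), and the outer inequality
`μ(o ↔ A)·min_a E F(C_a) ≤ Σ_a μ(P^o_a)·E F(C_a)` is recorded with it: this is (GENmin),
`E[F(C_o); o ↔ A] ≥ Σ_{a∈A} P(P^o_a)·m_a ≥ P(o ↔ A)·min_{a∈A} m_a`, for every finite graph with pair weights in `[0,1]`, every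
nonempty relay set with a compatible injective rank, every vertex `o` and every increasing real `F` on vertex sets.
[cite: KozmaNitzan2024, Conj. 1 (p. 3), Conj. 4 (p. 32)]
-/

noncomputable section

namespace Summit.CriticalPhenomena.PercolationContinuityZ3.Theorems

open MeasureTheory Set
open Literature.Probability.LatticeModels (prodBernoulli)
open Literature.Probability.Percolation
open scoped Classical

namespace EventGluingSharp

/-- **(GENmin) for every monotone cluster functional, on every finite weighted graph (weights in `[0,1]`).**  For `F` monotone on
vertex sets (no sign hypothesis), a nonempty relay set `A`, an observer `o` and a rank `r` injective on `A` and compatible with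
`a ↦ m_a := E F(C_a)`:  `μ(o ↔ A)·min_{a∈A} m_a ≤ Σ_{a∈A} μ({o ↔ a} ∩ ⋂_{a'∈A, r a' < r a} {o ↮ a'})·m_a ≤ ∫_{o ↔ A} F(C_o) dμ`.
(`gen_holds` applied to `F − F(∅) ≥ 0`; the first-in-rank patterns partition `{o ↔ A}`, `AGloc.sum_measureReal_firstRank`.)
[cite: KozmaNitzan2024, Conj. 1 (p. 3), Conj. 4 (p. 32)] -/
theorem genMin_holds (n : ℕ) (w : Sym2 (Fin n) → unitInterval) (A : Finset (Fin n)) (hA : A.Nonempty) (o : Fin n)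
    (F : Set (Fin n) → ℝ) (r : Fin n → ℕ) (hF : ∀ S S' : Set (Fin n), S ⊆ S' → F S ≤ F S') (hr : Set.InjOn r ↑A)
    (hcompat : ∀ a ∈ A, ∀ a' ∈ A, r a < r a' →
      ∫ ω, F (openCluster ω a) ∂(prodBernoulli w) ≤ ∫ ω, F (openCluster ω a') ∂(prodBernoulli w)) :
    (prodBernoulli w).real (⋃ a ∈ A, openConn o a) * A.inf' hA (fun a => ∫ ω, F (openCluster ω a) ∂(prodBernoulli w)) ≤
        ∑ a ∈ A, (prodBernoulli w).real
            (openConn o a ∩ ⋂ a' ∈ A.filter (fun a' => r a' < r a), (openConn o a')ᶜ : Set (BondConfig (Fin n))) *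
          ∫ ω, F (openCluster ω a) ∂(prodBernoulli w) ∧
      ∑ a ∈ A, (prodBernoulli w).real
            (openConn o a ∩ ⋂ a' ∈ A.filter (fun a' => r a' < r a), (openConn o a')ᶜ : Set (BondConfig (Fin n))) *
          ∫ ω, F (openCluster ω a) ∂(prodBernoulli w) ≤
        ∫ ω in (⋃ a ∈ A, openConn o a), F (openCluster ω o) ∂(prodBernoulli w) := by
  set μ := prodBernoulli w with hμ
  set W : Set (BondConfig (Fin n)) := ⋃ a ∈ A, openConn o a with hW
  set m : Fin n → ℝ := fun a => ∫ ω, F (openCluster ω a) ∂μ with hm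
  have hsum := AGloc.sum_measureReal_firstRank w A r o hr
  rw [← hμ] at hsum
  refine ⟨?_, ?_⟩
  · -- `μ(W)·min m = Σ_a μ(P_a)·min m ≤ Σ_a μ(P_a)·m_a`
    rw [← hsum, Finset.sum_mul]
    exact Finset.sum_le_sum fun a ha => mul_le_mul_of_nonneg_left (Finset.inf'_le _ ha) measureReal_nonneg
  · -- shift: `G := F − F ∅ ≥ 0` is monotone with the same compatible rank
    set G : Set (Fin n) → ℝ := fun S => F S - F ∅ with hG
    have hGmono : ∀ S S' : Set (Fin n), S ⊆ S' → G S ≤ G S' := fun S S' h => sub_le_sub_right (hF S S' h) _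
    have hG0 : ∀ S, 0 ≤ G S := fun S => sub_nonneg.2 (hF ∅ S (empty_subset S))
    have hintG : ∀ x : Fin n, ∫ ω, G (openCluster ω x) ∂μ = m x - F ∅ := by
      intro x
      simp only [hG]
      rw [integral_sub Integrable.of_finite Integrable.of_finite, integral_const, smul_eq_mul, probReal_univ, one_mul]
    have hcompatG : ∀ a ∈ A, ∀ a' ∈ A, r a < r a' →
        ∫ ω, G (openCluster ω a) ∂μ ≤ ∫ ω, G (openCluster ω a') ∂μ := by
      intro a ha a' ha' hlt
      rw [hintG a, hintG a']
      exact sub_le_sub_right (hcompat a ha a' ha' hlt) _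
    have key := gen_holds n w A o G r hGmono hG0 hr hcompatG
    rw [← hμ] at key
    simp only [hintG] at key
    have hsetG : ∫ ω in W, G (openCluster ω o) ∂μ = ∫ ω in W, F (openCluster ω o) ∂μ - F ∅ * μ.real W := by
      simp only [hG]
      rw [integral_sub Integrable.of_finite Integrable.of_finite, setIntegral_const, smul_eq_mul, mul_comm]
    rw [hsetG] at key
    have hsplit : ∑ a ∈ A, μ.real (openConn o a ∩ ⋂ a' ∈ A.filter (fun a' => r a' < r a), (openConn o a')ᶜ :
          Set (BondConfig (Fin n))) * (m a - F ∅) =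
        ∑ a ∈ A, μ.real (openConn o a ∩ ⋂ a' ∈ A.filter (fun a' => r a' < r a), (openConn o a')ᶜ :
          Set (BondConfig (Fin n))) * m a - F ∅ * μ.real W := by
      rw [← hsum, Finset.mul_sum, ← Finset.sum_sub_distrib]
      exact Finset.sum_congr rfl fun a _ => by ring
    rw [hsplit] at key
    linarith

end EventGluingSharp

end Summit.CriticalPhenomena.PercolationContinuityZ3.Theorems

end
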